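import Summits.QuantumFields.YangMills.Theorems.SwapVirialDeficitGnomonicDeficitSmooth
import Summits.QuantumFields.YangMills.Theorems.SwapVirialDeficitGnomonicSpeedLeaders
import Summits.QuantumFields.YangMills.Theorems.SwapVirialDeficitBlowUpGnomonicBaseFlat
import HarnessLib

/-!
# THE σ-GLUED DEFICIT IS SMOOTH JOINTLY IN THE HUB-POLAR SHIFT AND THE GNOMONIC COORDINATES: `(c, η) ↦ F̂(a − c·1, ε, η)` is `C^n` for `im a ≠ 0`
# (free-hands support of ⟨stmt-QuantumFields-24197⟩ `SwapVirialDeficit.SwapGluedStiffness`; region (Rd) of LEAD g98's skeleton ➎ — the hub-polar direction `δ` of the B-fibre is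
# a ray in the HUB variable; this is the regularity input for its Hessian floor, cf. ✓`fibre_raySecond_ge_stratumB_diag` for the letter directions)

`F̂ = gnoDeficit z χ a ε η` depends on the hub only through `A = ν(axisPoint a)`, `axisPoint a = (re a, ‖im a‖, 0, 0)`.  Along the REAL shift `a ↦ a − c·1` the imaginary part
is fixed, so `axisPoint(a − c·1) = axisPoint a − c·1` is AFFINE in `c` and never vanishes when `im a ≠ 0`; hence (✓`contDiffAt_radialUnit`, ✓`contDiff_chartDeficit_of_letters`)
* `im_sub_smul_one`, `sub_smul_one_ne_zero`, `axisPoint_sub_smul_one`, `contDiff_radialUnit_affine`, `star_radialUnit`, `contDiff_axisUnit_hubShift`;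
* ★ `contDiff_leader_hubShift`, ★★ `contDiff_gnoDeficit_hubShift (z χ) (ha : a.im ≠ 0) (ε) : ContDiff ℝ n (fun p : ℝ × GnoCoord L => gnoDeficit z χ (a − p.1 • 1) ε p.2)`,
  ★ `contDiff_gnoDeficit_hubShift_ray` (the joint ray `s ↦ F̂(a − (sδ′)·1, ε, η₀ + s·ζ)`).

HONEST LABEL: regularity bookkeeping; regions' stiffness, ⟨24197⟩ ∕ ⟨24194⟩ ∕ ⟨24497⟩ OPEN; own crux ⟨22884⟩ OPEN (blocked-on ⟨19935⟩); the Yang–Mills mass gap is NOT proved; no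
summit is proved by a line.  THEOREMS ONLY (0 `def`, 0 `sorry`), standard axioms.  Width seat ym-line-sfw-p2-w3 g66 (cell ym-idea-1, free hands),
`--supports stmt-QuantumFields-24197`.  References: [cite: Luscher1983, §2]; [folklore].
-/

set_option autoImplicit false
set_option synthInstance.maxSize 1024

noncomputable section

open Quaternion
open scoped Quaternion BigOperators ContDiff
open Literature.MathematicalPhysics.QuantumLattice
open Literature.MathematicalPhysics.QuantumFieldTheory hiding SU2
open Literature.Analysis.Calculus (radialUnit radialUnit_def norm_radialUnit)
open Summit.QuantumFields.YangMills.Theorems.FemtoTransferGap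
open Summit.QuantumFields.YangMills.Theorems.FemtoTransferGap.TT
open Summit.QuantumFields.YangMills.Theorems.SwapTwistDeficit.ToronLog (axisPoint)
open Summit.QuantumFields.YangMills.Theorems.SwapVirialDeficit.ZeroModeSigma (su2Quat_quatToSU2_eq_radialUnit slaveP norm_axisUnit dil3 dil3_apply)
open Summit.QuantumFields.YangMills.Theorems.SwapVirialDeficit.BlowUp (leaderTuple dil3_one' dilateIm_one_apply contDiffAt_radialUnit)
open Summit.QuantumFields.YangMills.Theorems.SwapVirialDeficit.BlowUpRing

namespace Summit.QuantumFields.YangMills.Theorems.SwapVirialDeficit.Gnomonic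

variable {L : ℕ} [NeZero L] {n : ℕ∞}

omit [NeZero L] in
/-- A real shift does not move the imaginary part. [folklore] -/
theorem im_sub_smul_one (a : ℍ) (c : ℝ) : (a - c • (1 : ℍ)).im = a.im := by
  ext <;> simp

omit [NeZero L] in
/-- A real shift of a hub with `im a ≠ 0` is nonzero. [folklore] -/
theorem sub_smul_one_ne_zero {a : ℍ} (ha : a.im ≠ 0) (c : ℝ) : a - c • (1 : ℍ) ≠ 0 := by
  intro h
  apply ha
  rw [← im_sub_smul_one a c, h]
  rfl

omit [NeZero L] in
/-- `axisPoint (a − c·1) = axisPoint a − c·1` — affine in the shift. [folklore] -/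
theorem axisPoint_sub_smul_one (a : ℍ) (c : ℝ) : axisPoint (a - c • (1 : ℍ)) = axisPoint a - c • (1 : ℍ) := by
  have him := im_sub_smul_one a c
  ext <;> simp [axisPoint, him]

omit [NeZero L] in
/-- An affine real shift of a quaternion with `imI ≠ 0` never vanishes. [folklore] -/
theorem sub_smul_one_ne_zero_of_imI {P : ℍ} (hP : P.imI ≠ 0) (c : ℝ) : P - c • (1 : ℍ) ≠ 0 := by
  intro h
  have h1 : (P - c • (1 : ℍ)).imI = 0 := by rw [h]; rfl
  simp at h1
  exact hP h1

omit [NeZero L] in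
/-- ★ `c ↦ ν(P − c·1)` is `C^n` when `imI P ≠ 0`. [folklore] -/
theorem contDiff_radialUnit_affine {P : ℍ} (hP : P.imI ≠ 0) : ContDiff ℝ n fun c : ℝ => radialUnit (P - c • (1 : ℍ)) := by
  have haff : ContDiff ℝ n fun c : ℝ => P - c • (1 : ℍ) := contDiff_const.sub (contDiff_id.smul contDiff_const)
  refine contDiff_iff_contDiffAt.2 fun c => ?_
  have h1 : ContDiffAt ℝ n (radialUnit (E := ℍ)) (P - c • (1 : ℍ)) := contDiffAt_radialUnit (sub_smul_one_ne_zero_of_imI hP c)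
  exact h1.comp c haff.contDiffAt

omit [NeZero L] in
/-- `star ν(x) = ν(star x)`. [folklore] -/
theorem star_radialUnit (x : ℍ) : star (radialUnit x) = radialUnit (star x) := by
  rw [radialUnit_def, radialUnit_def, norm_star]
  ext <;> simp

omit [NeZero L] in
/-- ★ The hub unit along the real shift, `c ↦ ν(axisPoint (a − c·1))`, and its conjugate are `C^n` (`im a ≠ 0`). [folklore] -/
theorem contDiff_axisUnit_hubShift {a : ℍ} (ha : a.im ≠ 0) :
    (ContDiff ℝ n fun c : ℝ => radialUnit (axisPoint (a - c • (1 : ℍ)))) ∧ ContDiff ℝ n fun c : ℝ => star (radialUnit (axisPoint (a - c • (1 : ℍ)))) := by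
  have hI : (axisPoint a).imI ≠ 0 := by
    simp only [axisPoint, ne_eq, norm_eq_zero]; exact ha
  have hI' : (star (axisPoint a)).imI ≠ 0 := by
    rw [Quaternion.imI_star]; exact neg_ne_zero.2 hI
  have e1 : (fun c : ℝ => radialUnit (axisPoint (a - c • (1 : ℍ)))) = fun c : ℝ => radialUnit (axisPoint a - c • (1 : ℍ)) :=
    funext fun c => by rw [axisPoint_sub_smul_one]
  have e2 : (fun c : ℝ => star (radialUnit (axisPoint (a - c • (1 : ℍ))))) = fun c : ℝ => radialUnit (star (axisPoint a) - c • (1 : ℍ)) :=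
    funext fun c => by
      rw [axisPoint_sub_smul_one, star_radialUnit, star_sub, Quaternion.star_smul, star_one]
  rw [e1, e2]
  exact ⟨contDiff_radialUnit_affine hI, contDiff_radialUnit_affine hI'⟩

/-- ★ **Every leader of `blowUpPoint 1 (gnomonicPoint (a − c·1) ε η)` is `C^n` jointly in `(c, η)`** (`im a ≠ 0`). [folklore] -/
theorem contDiff_leader_hubShift {a : ℍ} (ha : a.im ≠ 0) (ε : GnoSign L) (μ : Fin 4) :
    ContDiff ℝ n fun p : ℝ × GnoCoord L => su2Quat ((blowUpPoint (L := L) 1 (gnomonicPoint (a - p.1 • (1 : ℍ)) ε p.2)).1 μ) := by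
  have hx : ContDiff ℝ n fun p : ℝ × GnoCoord L => su2Quat (quatToSU2 (gnoLetter ε.1.1 p.2.1.1)) :=
    (contDiff_radialUnit_gnoLetter ε.1.1).comp (contDiff_fst.comp (contDiff_fst.comp contDiff_snd))
  have hy : ContDiff ℝ n fun p : ℝ × GnoCoord L => su2Quat (quatToSU2 (gnoLetter ε.1.2 p.2.1.2)) :=
    (contDiff_radialUnit_gnoLetter ε.1.2).comp (contDiff_snd.comp (contDiff_fst.comp contDiff_snd))
  have hz : ContDiff ℝ n fun p : ℝ × GnoCoord L => su2Quat (quatToSU2 (gnoLetter ε.2.1 p.2.2.1)) :=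
    (contDiff_radialUnit_gnoLetter ε.2.1).comp (contDiff_fst.comp (contDiff_snd.comp contDiff_snd))
  have hA : ContDiff ℝ n fun p : ℝ × GnoCoord L => radialUnit (axisPoint (a - p.1 • (1 : ℍ))) := (contDiff_axisUnit_hubShift ha).1.comp contDiff_fst
  have hAs : ContDiff ℝ n fun p : ℝ × GnoCoord L => star (radialUnit (axisPoint (a - p.1 • (1 : ℍ)))) :=
    (contDiff_axisUnit_hubShift ha).2.comp contDiff_fst
  have ha' : ∀ p : ℝ × GnoCoord L, a - p.1 • (1 : ℍ) ≠ 0 := fun p => sub_smul_one_ne_zero ha p.1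
  match μ with
  | ⟨0, _⟩ =>
    have e : ∀ p : ℝ × GnoCoord L, su2Quat ((blowUpPoint (L := L) 1 (gnomonicPoint (a - p.1 • (1 : ℍ)) ε p.2)).1 ⟨0, by omega⟩) =
        su2Quat (quatToSU2 (gnoLetter ε.1.1 p.2.1.1)) := fun p => by
      show su2Quat (leaderTuple (a - p.1 • (1 : ℍ)) (dil3 1 (gnomonicPoint (a - p.1 • (1 : ℍ)) ε p.2).2.1) 0) = _
      rw [(BlowUp.leaderTuple_apply _ _).1, dil3_one']; rfl
    simp only [e]; exact hx
  | ⟨1, _⟩ =>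
    have e : ∀ p : ℝ × GnoCoord L, su2Quat ((blowUpPoint (L := L) 1 (gnomonicPoint (a - p.1 • (1 : ℍ)) ε p.2)).1 ⟨1, by omega⟩) =
        star (radialUnit (axisPoint (a - p.1 • (1 : ℍ)))) * su2Quat (quatToSU2 (gnoLetter ε.1.1 p.2.1.1)) * radialUnit (axisPoint (a - p.1 • (1 : ℍ))) *
          su2Quat (quatToSU2 (gnoLetter ε.2.1 p.2.2.1)) := fun p => by
      show su2Quat (leaderTuple (a - p.1 • (1 : ℍ)) (dil3 1 (gnomonicPoint (a - p.1 • (1 : ℍ)) ε p.2).2.1) 1) = _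
      rw [(BlowUp.leaderTuple_apply _ _).2.1, dil3_one']
      exact su2Quat_quatToSU2_slaveP_mul (norm_axisUnit (ha' p)) (gnoLetter_ne_zero _ _) (gnoLetter_ne_zero _ _)
    simp only [e]
    exact ((hAs.mul hx).mul hA).mul hz
  | ⟨2, _⟩ =>
    have e : ∀ p : ℝ × GnoCoord L, su2Quat ((blowUpPoint (L := L) 1 (gnomonicPoint (a - p.1 • (1 : ℍ)) ε p.2)).1 ⟨2, by omega⟩) =
        su2Quat (quatToSU2 (gnoLetter ε.1.2 p.2.1.2)) := fun p => by
      show su2Quat (leaderTuple (a - p.1 • (1 : ℍ)) (dil3 1 (gnomonicPoint (a - p.1 • (1 : ℍ)) ε p.2).2.1) 2) = _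
      rw [(BlowUp.leaderTuple_apply _ _).2.2.1, dil3_one']; rfl
    simp only [e]; exact hy
  | ⟨3, _⟩ =>
    have e : ∀ p : ℝ × GnoCoord L, su2Quat ((blowUpPoint (L := L) 1 (gnomonicPoint (a - p.1 • (1 : ℍ)) ε p.2)).1 ⟨3, by omega⟩) =
        radialUnit (axisPoint (a - p.1 • (1 : ℍ))) := fun p => by
      show su2Quat (leaderTuple (a - p.1 • (1 : ℍ)) (dil3 1 (gnomonicPoint (a - p.1 • (1 : ℍ)) ε p.2).2.1) 3) = _
      rw [(BlowUp.leaderTuple_apply _ _).2.2.2]; exact su2Quat_quatToSU2_axisUnit (ha' p)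
    simp only [e]; exact hA

/-- ★ Every follower is `C^n` jointly in `(c, η)` (it does not see the hub). [folklore] -/
theorem contDiff_follower_hubShift (a : ℍ) (ε : GnoSign L) (i : Fol L) :
    ContDiff ℝ n fun p : ℝ × GnoCoord L => su2Quat ((blowUpPoint (L := L) 1 (gnomonicPoint (a - p.1 • (1 : ℍ)) ε p.2)).2 i) := by
  have e : ∀ p : ℝ × GnoCoord L, su2Quat ((blowUpPoint (L := L) 1 (gnomonicPoint (a - p.1 • (1 : ℍ)) ε p.2)).2 i) =
      su2Quat (quatToSU2 (gnoLetter (ε.2.2 i) (p.2.2.2 i))) := fun p => by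
    rw [gnoFollower_eq]
  simp only [e]
  have hπ : ContDiff ℝ n fun p : ℝ × GnoCoord L => p.2.2.2 i := (contDiff_apply ℝ (Fin 3 → ℝ) i).comp (contDiff_snd.comp (contDiff_snd.comp contDiff_snd))
  exact (contDiff_radialUnit_gnoLetter (ε.2.2 i)).comp hπ

set_option maxHeartbeats 800000 in
/-- ★★ **THE σ-GLUED DEFICIT IS `C^n` JOINTLY IN THE HUB SHIFT AND THE GNOMONIC COORDINATES** (`im a ≠ 0`):
`(c, η) ↦ gnoDeficit z χ (a − c·1) ε η` is `C^n` on `ℝ × GnoCoord L`. [cite: Luscher1983, §2] -/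
theorem contDiff_gnoDeficit_hubShift (z : Fin 3 → Bool) (χ : Site 3 L → SU2) {a : ℍ} (ha : a.im ≠ 0) (ε : GnoSign L) :
    ContDiff ℝ n fun p : ℝ × GnoCoord L => gnoDeficit z χ (a - p.1 • (1 : ℍ)) ε p.2 :=
  contDiff_chartDeficit_of_letters (C := fun p : ℝ × GnoCoord L => (blowUpPoint (L := L) 1 (gnomonicPoint (a - p.1 • (1 : ℍ)) ε p.2)).1)
    (U := fun p : ℝ × GnoCoord L => (blowUpPoint (L := L) 1 (gnomonicPoint (a - p.1 • (1 : ℍ)) ε p.2)).2) z χ (contDiff_leader_hubShift ha ε)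
    (contDiff_follower_hubShift a ε)

set_option maxHeartbeats 400000 in
/-- ★ **The joint ray** `s ↦ F̂(a − (s·δ′)·1, ε, η₀ + s·ζ)` is `C^n` (`im a ≠ 0`). [folklore] -/
theorem contDiff_gnoDeficit_hubShift_ray (z : Fin 3 → Bool) (χ : Site 3 L → SU2) {a : ℍ} (ha : a.im ≠ 0) (ε : GnoSign L) (δ : ℝ) (η₀ ζ : GnoCoord L) :
    ContDiff ℝ n fun s : ℝ => gnoDeficit z χ (a - (s * δ) • (1 : ℍ)) ε (η₀ + s • ζ) := by
  have hpath : ContDiff ℝ n fun s : ℝ => ((s * δ, η₀ + s • ζ) : ℝ × GnoCoord L) :=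
    (contDiff_id.mul contDiff_const).prodMk (contDiff_const.add (contDiff_id.smul contDiff_const))
  have e : (fun s : ℝ => gnoDeficit z χ (a - (s * δ) • (1 : ℍ)) ε (η₀ + s • ζ)) =
      (fun p : ℝ × GnoCoord L => gnoDeficit z χ (a - p.1 • (1 : ℍ)) ε p.2) ∘ fun s : ℝ => ((s * δ, η₀ + s • ζ) : ℝ × GnoCoord L) := rfl
  rw [e]
  exact (contDiff_gnoDeficit_hubShift z χ ha ε).comp hpath

end Summit.QuantumFields.YangMills.Theorems.SwapVirialDeficit.Gnomonic

end
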